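import Summits.Ventures.PercRepro.S1CFGSimpleFive
import Summits.Ventures.PercRepro.S1CFNullity

/-!
# PercRepro — THE TRIANGLE CAP OF A SIMPLE COLOOP-FREE MATROID: `c₃ ≤ C(ν + 1, 3) + 1` (p1, gen 39; feeder of S2's row `p = 12`)

For a simple (no dependent pair), coloop-free matroid of nullity `ν` on `n ≥ 2ν + 2` points, the number of `3`-sets of rank
`≤ 2` (= the triangles) is at most `C(ν + 1, 3) + 1` — against the landed `C(ν + 2, 3)` of S1CFGSimpleFive (`35 → 21` at
`ν = 5`, `56 → 36` at `ν = 6`), which is attained only by a `(ν + 2)`-point line plus coloops. The `+ 1` is necessary: two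
disjoint triangles (`ν = 2`, `n = 6`) have `2 = C(3, 3) + 1` triangles.

THE PROOF. Write `rk X := (M.eRk X).toNat` and `ψ(X) := 2·rk X − |X|`. Take a rank-`2` triple `T₀` and a set `S ⊇ T₀`
MAXIMAL (for inclusion) with `ψ(S) ≤ 1`. `ψ` is submodular (rank is), and `ψ ≥ 1` on every non-empty subset of a triangle
(points, pairs and the triangle itself have `ψ = 1, 2, 1`), so `ψ(S ∪ T) ≤ ψ(S)` for every triangle `T` meeting `S`:
`S` is triangle-closed (`two_mul_eRk_toNat_union_le_of_inter_nonempty`). Since `ψ(E) = n − 2ν ≥ 2`, `S ≠ E`. Every triangle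
lies in `S` or in `E ∖ S`, and the landed cap on the restrictions gives `c₃ ≤ C(a + 2, 3) + C(b + 2, 3)` with `a = ν(S)`,
`b = ν(E ∖ S)`; `1 ≤ a ≤ ν − 1` (`T₀ ⊆ S`; a proper subset of a coloop-free matroid, S1CFNullity), `a + b ≤ ν`
(subadditivity), and `C(a + 2, 3) + C(b + 2, 3) ≤ C(a + b + 1, 3) + 1` for `a, b ≥ 1` (Pascal, `choose_add_choose_le`).

* **`ncard_three_eRk_le_two_le_choose_succ_add_one`** — the cap;
* `choose_add_choose_le`, `choose_add_choose_le_of_add_le` — the arithmetic;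
* `ncard_three_eRk_le_two_le_of_no_dep_pair_restrict` — the landed cap on a restriction `M ↾ S`;
* `triangles_le_eleven_of_nullity_four`, `triangles_le_twentyone_of_nullity_five`, `triangles_le_thirtysix_of_nullity_six` — the numerals
  `11 / 21 / 36` at `ν = 4, 5, 6` on `n ≥ 10 / 12 / 14` points (the landed caps: `20 / 35 / 56`).
Nothing about any cell is claimed. Axioms: standard.
-/

open scoped Matroid

namespace PercRepro

namespace S1CFG

open Set S1CF

variable {α : Type}

/-- `C(a + 2, 3) + C(b + 2, 3) ≤ C(a + b + 1, 3) + 1` for `a, b ≥ 1` (Pascal, induction on `b`). -/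
theorem choose_add_choose_le (a : ℕ) (ha : 1 ≤ a) : ∀ b : ℕ, 1 ≤ b →
    (a + 2).choose 3 + (b + 2).choose 3 ≤ (a + b + 1).choose 3 + 1 := by
  intro b hb
  induction b, hb using Nat.le_induction with
  | base => simp
  | succ b hb ih =>
    have h1 : (b + 1 + 2).choose 3 = (b + 2).choose 2 + (b + 2).choose 3 := by
      rw [show b + 1 + 2 = (b + 2) + 1 by omega]
      exact Nat.choose_succ_succ' (b + 2) 2
    have h2 : (a + (b + 1) + 1).choose 3 = (a + b + 1).choose 2 + (a + b + 1).choose 3 := by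
      rw [show a + (b + 1) + 1 = (a + b + 1) + 1 by omega]
      exact Nat.choose_succ_succ' (a + b + 1) 2
    have h3 : (b + 2).choose 2 ≤ (a + b + 1).choose 2 := Nat.choose_le_choose 2 (by omega)
    omega

/-- `C(a + 2, 3) + C(b + 2, 3) ≤ C(ν + 1, 3) + 1` when `1 ≤ a ≤ ν − 1` and `a + b ≤ ν`. -/
theorem choose_add_choose_le_of_add_le {a b ν : ℕ} (ha : 1 ≤ a) (ha' : a + 1 ≤ ν) (hab : a + b ≤ ν) :
    (a + 2).choose 3 + (b + 2).choose 3 ≤ (ν + 1).choose 3 + 1 := by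
  rcases Nat.eq_zero_or_pos b with hb | hb
  · have h1 : (a + 2).choose 3 ≤ (ν + 1).choose 3 := Nat.choose_le_choose 3 (by omega)
    have h2 : (b + 2).choose 3 = 0 := by rw [hb]; decide
    omega
  · have h := choose_add_choose_le a ha b hb
    have : (a + b + 1).choose 3 ≤ (ν + 1).choose 3 := Nat.choose_le_choose 3 (by omega)
    omega

/-- No dependent pair (as a count) ⇒ every `2`-subset of the ground set is independent. -/
theorem indep_of_ncard_eq_two_of_no_dep_pair (M : Matroid α) [M.Finite]
    (h0 : {P : Set α | P ⊆ M.E ∧ P.ncard = 2 ∧ M.Dep P}.ncard = 0) {P : Set α} (hPE : P ⊆ M.E)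
    (hP2 : P.ncard = 2) : M.Indep P := by
  have hEfin := M.ground_finite
  rw [Set.ncard_eq_zero (hEfin.finite_subsets.subset (fun P hP => hP.1))] at h0
  rw [Matroid.indep_iff_not_dep]
  refine ⟨fun hdep => ?_, hPE⟩
  have hmem : P ∈ {P : Set α | P ⊆ M.E ∧ P.ncard = 2 ∧ M.Dep P} := ⟨hPE, hP2, hdep⟩
  rw [h0] at hmem
  exact hmem

/-- **`ψ ≥ 1` on a non-empty subset of a rank-`≤ 2` triple** (no dependent pair): `|Y| + 1 ≤ 2·rk Y`. -/
theorem ncard_add_one_le_two_mul_eRk_toNat_of_subset_three (M : Matroid α) [M.Finite]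
    (h0 : {P : Set α | P ⊆ M.E ∧ P.ncard = 2 ∧ M.Dep P}.ncard = 0) {X Y : Set α} (hX : X ⊆ M.E)
    (hX3 : X.ncard = 3) (hYX : Y ⊆ X) (hYne : Y.Nonempty) :
    Y.ncard + 1 ≤ 2 * (M.eRk Y).toNat := by
  have hEfin := M.ground_finite
  have hXfin : X.Finite := hEfin.subset hX
  have hYfin : Y.Finite := hXfin.subset hYX
  have hYpos : 1 ≤ Y.ncard := (Set.ncard_pos hYfin).mpr hYne
  have hYle : Y.ncard ≤ 3 := hX3 ▸ Set.ncard_le_ncard hYX hXfin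
  -- a `2`-subset `P` of `X` containing `Y ∩ (a 2-set)`: every `2`-subset of `X` is independent
  obtain ⟨P, hPX, hP2⟩ : ∃ P, P ⊆ X ∧ P.ncard = 2 := by
    obtain ⟨P, hPX, hPc⟩ := Set.exists_subset_encard_eq (s := X) (k := 2)
      (by rw [← hXfin.cast_ncard_eq, hX3]; exact_mod_cast (by norm_num : 2 ≤ 3))
    refine ⟨P, hPX, ?_⟩
    have : P.Finite := hXfin.subset hPX
    rw [← this.cast_ncard_eq] at hPc
    exact_mod_cast hPc
  have hPind : M.Indep P := indep_of_ncard_eq_two_of_no_dep_pair M h0 (hPX.trans hX) hP2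
  have hPrk : M.eRk P = 2 := by
    rw [hPind.eRk_eq_encard, ← (hXfin.subset hPX).cast_ncard_eq, hP2]; rfl
  rcases Nat.lt_or_ge Y.ncard 3 with hYlt | hY3
  · -- `|Y| ≤ 2`: `Y` sits in some independent `2`-subset of `X`
    obtain ⟨Q, hYQ, hQX, hQc⟩ := Set.exists_superset_subset_encard_eq (s := Y) (t := X) (k := 2) hYX
      (by rw [← hYfin.cast_ncard_eq]; exact_mod_cast (by omega : Y.ncard ≤ 2))
      (by rw [← hXfin.cast_ncard_eq, hX3]; exact_mod_cast (by norm_num : 2 ≤ 3))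
    have hQ2 : Q.ncard = 2 := by
      have : Q.Finite := hXfin.subset hQX
      rw [← this.cast_ncard_eq] at hQc
      exact_mod_cast hQc
    have hQind : M.Indep Q := indep_of_ncard_eq_two_of_no_dep_pair M h0 (hQX.trans hX) hQ2
    have hYind : M.Indep Y := hQind.subset hYQ
    have hYrk : (M.eRk Y).toNat = Y.ncard := by
      rw [hYind.eRk_eq_encard, ← hYfin.cast_ncard_eq]; rfl
    omega
  · -- `|Y| = 3`: `Y = X`, of rank `≥ 2`
    have hYX' : Y = X := Set.eq_of_subset_of_ncard_le hYX (by omega) hXfin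
    subst hYX'
    have h2 : (2 : ℕ∞) ≤ M.eRk Y := hPrk ▸ M.eRk_mono hPX
    rw [← S1.coe_toNat_eRk M (hYX.trans hX)] at h2
    have h2' : 2 ≤ (M.eRk Y).toNat := by exact_mod_cast h2
    omega

/-- **The closedness step**: if `2·rk S ≤ |S| + 1` and a rank-`≤ 2` triple `X` meets `S`, then
`2·rk (S ∪ X) ≤ |S ∪ X| + 1` (submodularity of `ψ` and `ψ ≥ 1` on `S ∩ X`). -/
theorem two_mul_eRk_toNat_union_le_of_inter_nonempty (M : Matroid α) [M.Finite]
    (h0 : {P : Set α | P ⊆ M.E ∧ P.ncard = 2 ∧ M.Dep P}.ncard = 0) {S X : Set α} (hS : S ⊆ M.E)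
    (hX : X ⊆ M.E) (hX3 : X.ncard = 3) (hXr : M.eRk X ≤ 2) (hSX : (S ∩ X).Nonempty)
    (hψ : 2 * (M.eRk S).toNat ≤ S.ncard + 1) :
    2 * (M.eRk (S ∪ X)).toNat ≤ (S ∪ X).ncard + 1 := by
  have hEfin := M.ground_finite
  have hSfin : S.Finite := hEfin.subset hS
  have hXfin : X.Finite := hEfin.subset hX
  have hsub := M.eRk_inter_add_eRk_union_le S X
  have hSXE : S ∩ X ⊆ M.E := inter_subset_left.trans hS
  have hUE : S ∪ X ⊆ M.E := union_subset hS hX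
  rw [← S1.coe_toNat_eRk M hSXE, ← S1.coe_toNat_eRk M hUE, ← S1.coe_toNat_eRk M hS, ← S1.coe_toNat_eRk M hX]
    at hsub
  have hsub' : (M.eRk (S ∩ X)).toNat + (M.eRk (S ∪ X)).toNat ≤ (M.eRk S).toNat + (M.eRk X).toNat := by
    exact_mod_cast hsub
  have hXr' : (M.eRk X).toNat ≤ 2 := by
    rw [← S1.coe_toNat_eRk M hX] at hXr
    exact_mod_cast hXr
  have hψI := ncard_add_one_le_two_mul_eRk_toNat_of_subset_three M h0 hX hX3 inter_subset_right hSX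
  have hcard := Set.ncard_union_add_ncard_inter S X hSfin hXfin
  omega

/-- The landed cap `D₃ ≤ C(ν' + 2, 3)` on a restriction `M ↾ S` (`S ⊆ E`, `ν' = |S| − rk S`), read back in `M`:
`#{X ⊆ S : |X| = 3, rk X ≤ 2} ≤ C(|S| − rk S + 2, 3)`. -/
theorem ncard_three_eRk_le_two_le_of_no_dep_pair_restrict (M : Matroid α) [M.Finite]
    (h0 : {P : Set α | P ⊆ M.E ∧ P.ncard = 2 ∧ M.Dep P}.ncard = 0) {S : Set α} (hS : S ⊆ M.E) :
    {X : Set α | X ⊆ S ∧ X.ncard = 3 ∧ M.eRk X ≤ 2}.ncard ≤ (S.ncard - (M.eRk S).toNat + 2).choose 3 := by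
  have hEfin := M.ground_finite
  have hSfin : S.Finite := hEfin.subset hS
  haveI : (M ↾ S).Finite := M.restrict_finite hSfin
  have hrkS : (M.eRk S).toNat ≤ S.ncard := by
    have := M.eRk_le_encard S
    rw [← S1.coe_toNat_eRk M hS, ← hSfin.cast_ncard_eq] at this
    exact_mod_cast this
  obtain ⟨r, hr⟩ : ∃ r : ℕ, M.eRk S = r := ⟨_, (S1.coe_toNat_eRk M hS).symm⟩
  have hrS : (M.eRk S).toNat = r := by rw [hr]; exact ENat.toNat_coe r
  have hd : (M ↾ S).E.encard = (M ↾ S).eRank + ((S.ncard - (M.eRk S).toNat : ℕ) : ℕ∞) := by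
    rw [hrS, Matroid.restrict_ground_eq, Matroid.eRank_restrict, hr, ← hSfin.cast_ncard_eq,
      ← Nat.cast_add]
    congr 1
    omega
  have h0' : {P : Set α | P ⊆ (M ↾ S).E ∧ P.ncard = 2 ∧ (M ↾ S).Dep P}.ncard = 0 := by
    rw [Set.ncard_eq_zero (hSfin.finite_subsets.subset (fun P hP => hP.1))]
    rw [Set.eq_empty_iff_forall_notMem]
    intro P hP
    obtain ⟨hPS, hP2, hPdep⟩ := hP
    rw [Matroid.restrict_ground_eq] at hPS
    rw [Matroid.restrict_dep_iff] at hPdep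
    have hPind := indep_of_ncard_eq_two_of_no_dep_pair M h0 (hPS.trans hS) hP2
    exact hPdep.1 hPind
  have hcap := ncard_three_eRk_le_two_le_of_no_dep_pair (M ↾ S) hd h0'
  have hset : {X : Set α | X ⊆ (M ↾ S).E ∧ X.ncard = 3 ∧ (M ↾ S).eRk X ≤ 2} =
      {X : Set α | X ⊆ S ∧ X.ncard = 3 ∧ M.eRk X ≤ 2} := by
    ext X
    simp only [Set.mem_setOf_eq, Matroid.restrict_ground_eq]
    constructor
    · rintro ⟨hXS, hX3, hXr⟩
      rw [Matroid.restrict_eRk_eq M hXS] at hXr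
      exact ⟨hXS, hX3, hXr⟩
    · rintro ⟨hXS, hX3, hXr⟩
      rw [Matroid.restrict_eRk_eq M hXS]
      exact ⟨hXS, hX3, hXr⟩
  rw [hset] at hcap
  exact hcap

/-- **THE TRIANGLE CAP**: a simple (no dependent pair), coloop-free matroid of nullity `ν` on `n ≥ 2ν + 2` points has
at most `C(ν + 1, 3) + 1` triangles (`3`-sets of rank `≤ 2`). -/
theorem ncard_three_eRk_le_two_le_choose_succ_add_one (M : Matroid α) [M.Finite] {ν : ℕ}
    (hd : M.E.encard = M.eRank + (ν : ℕ∞)) (hK : ∀ e, ¬ M.IsColoop e)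
    (h0 : {P : Set α | P ⊆ M.E ∧ P.ncard = 2 ∧ M.Dep P}.ncard = 0) (hn : 2 * ν + 2 ≤ M.E.ncard) :
    {X : Set α | X ⊆ M.E ∧ X.ncard = 3 ∧ M.eRk X ≤ 2}.ncard ≤ (ν + 1).choose 3 + 1 := by
  classical
  have hEfin := M.ground_finite
  set 𝒯 := {X : Set α | X ⊆ M.E ∧ X.ncard = 3 ∧ M.eRk X ≤ 2} with h𝒯
  have h𝒯fin : 𝒯.Finite := hEfin.finite_subsets.subset (fun X hX => hX.1)
  rcases 𝒯.eq_empty_or_nonempty with h𝒯e | ⟨T₀, hT₀⟩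
  · rw [h𝒯e, Set.ncard_empty]; exact Nat.zero_le _
  simp only [h𝒯, Set.mem_setOf_eq] at hT₀
  obtain ⟨hT₀E, hT₀3, hT₀r⟩ := hT₀
  have hnE := ncard_ground_eq_eRk_toNat_add M hd
  -- the family of `S ⊇ T₀` with `ψ(S) ≤ 1`, and a maximal member
  set 𝒮 := {S : Set α | S ⊆ M.E ∧ T₀ ⊆ S ∧ 2 * (M.eRk S).toNat ≤ S.ncard + 1} with h𝒮
  have h𝒮fin : 𝒮.Finite := hEfin.finite_subsets.subset (fun S hS => hS.1)
  have hT₀r' : (M.eRk T₀).toNat ≤ 2 := by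
    rw [← S1.coe_toNat_eRk M hT₀E] at hT₀r
    exact_mod_cast hT₀r
  have h𝒮ne : 𝒮.Nonempty := ⟨T₀, hT₀E, subset_refl _, by omega⟩
  obtain ⟨S, ⟨hSE, hT₀S, hψ⟩, hSmax⟩ := h𝒮fin.exists_maximal h𝒮ne
  have hSfin : S.Finite := hEfin.subset hSE
  -- `S ≠ E`
  have hSne : S ≠ M.E := by
    intro hSeq
    rw [hSeq] at hψ
    omega
  -- closedness: a triple of `𝒯` meeting `S` lies in `S`
  have hclosed : ∀ X ∈ 𝒯, (S ∩ X).Nonempty → X ⊆ S := by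
    intro X hX hSX
    simp only [h𝒯, Set.mem_setOf_eq] at hX
    obtain ⟨hXE, hX3, hXr⟩ := hX
    have hmem : S ∪ X ∈ 𝒮 :=
      ⟨union_subset hSE hXE, hT₀S.trans subset_union_left,
        two_mul_eRk_toNat_union_le_of_inter_nonempty M h0 hSE hXE hX3 hXr hSX hψ⟩
    have hle : S ∪ X ⊆ S := hSmax hmem subset_union_left
    exact subset_union_right.trans hle
  -- the split of `𝒯`
  have hsplit : 𝒯 ⊆ {X : Set α | X ⊆ S ∧ X.ncard = 3 ∧ M.eRk X ≤ 2} ∪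
      {X : Set α | X ⊆ M.E \ S ∧ X.ncard = 3 ∧ M.eRk X ≤ 2} := by
    intro X hX
    have hX' := hX
    simp only [h𝒯, Set.mem_setOf_eq] at hX'
    obtain ⟨hXE, hX3, hXr⟩ := hX'
    rcases (S ∩ X).eq_empty_or_nonempty with hSX | hSX
    · right
      refine ⟨fun x hx => ⟨hXE hx, fun hxS => ?_⟩, hX3, hXr⟩
      have : x ∈ S ∩ X := ⟨hxS, hx⟩
      rw [hSX] at this
      exact this
    · left
      exact ⟨hclosed X hX hSX, hX3, hXr⟩
  have hcount : 𝒯.ncard ≤ {X : Set α | X ⊆ S ∧ X.ncard = 3 ∧ M.eRk X ≤ 2}.ncard +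
      {X : Set α | X ⊆ M.E \ S ∧ X.ncard = 3 ∧ M.eRk X ≤ 2}.ncard := by
    refine (Set.ncard_le_ncard hsplit ?_).trans (Set.ncard_union_le _ _)
    exact (hEfin.finite_subsets.subset (fun X hX => hX.1.trans hSE)).union
      (hEfin.finite_subsets.subset (fun X hX => hX.1.trans sdiff_subset))
  have hcapS := ncard_three_eRk_le_two_le_of_no_dep_pair_restrict M h0 hSE
  have hcapC := ncard_three_eRk_le_two_le_of_no_dep_pair_restrict M h0 (sdiff_subset : M.E \ S ⊆ M.E)
  -- the nullities `a = ν(S)`, `b = ν(E ∖ S)`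
  have hrkS : (M.eRk S).toNat ≤ S.ncard := by
    have := M.eRk_le_encard S
    rw [← S1.coe_toNat_eRk M hSE, ← hSfin.cast_ncard_eq] at this
    exact_mod_cast this
  have ha1 : (M.eRk S).toNat + 1 ≤ S.ncard := by
    have := ncard_add_eRk_le_of_subset M hSE hT₀S
    omega
  have haν : S.ncard + 1 ≤ (M.eRk S).toNat + ν :=
    ncard_add_one_le_eRk_toNat_add_of_ssubset M hd hK hSE hSne
  have hCfin : (M.E \ S).Finite := hEfin.subset sdiff_subset
  have hrkC : (M.eRk (M.E \ S)).toNat ≤ (M.E \ S).ncard := by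
    have := M.eRk_le_encard (M.E \ S)
    rw [← S1.coe_toNat_eRk M sdiff_subset, ← hCfin.cast_ncard_eq] at this
    exact_mod_cast this
  have hsubadd : (M.eRk M.E).toNat ≤ (M.eRk S).toNat + (M.eRk (M.E \ S)).toNat := by
    have := M.eRk_union_le_eRk_add_eRk S (M.E \ S)
    rw [union_sdiff_cancel hSE, ← S1.coe_toNat_eRk M (subset_refl M.E), ← S1.coe_toNat_eRk M hSE,
      ← S1.coe_toNat_eRk M sdiff_subset] at this
    exact_mod_cast this
  have hcardsplit := Set.ncard_sdiff_add_ncard_of_subset hSE hEfin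
  -- assemble
  have hfinal := choose_add_choose_le_of_add_le (a := S.ncard - (M.eRk S).toNat)
    (b := (M.E \ S).ncard - (M.eRk (M.E \ S)).toNat) (ν := ν) (by omega) (by omega) (by omega)
  calc 𝒯.ncard ≤ _ := hcount
    _ ≤ (S.ncard - (M.eRk S).toNat + 2).choose 3 +
        ((M.E \ S).ncard - (M.eRk (M.E \ S)).toNat + 2).choose 3 := Nat.add_le_add hcapS hcapC
    _ ≤ (ν + 1).choose 3 + 1 := hfinal

/-- The triangle cap at nullity `5` on `≥ 12` points: `c₃ ≤ 21` (the landed cap: `35`). -/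
theorem triangles_le_twentyone_of_nullity_five (M : Matroid α) [M.Finite]
    (hd : M.E.encard = M.eRank + ((5 : ℕ) : ℕ∞)) (hK : ∀ e, ¬ M.IsColoop e)
    (h0 : {P : Set α | P ⊆ M.E ∧ P.ncard = 2 ∧ M.Dep P}.ncard = 0) (hn : 12 ≤ M.E.ncard) :
    {X : Set α | X ⊆ M.E ∧ X.ncard = 3 ∧ M.eRk X ≤ 2}.ncard ≤ 21 := by
  have h := ncard_three_eRk_le_two_le_choose_succ_add_one M hd hK h0 (by omega)
  exact h.trans (by decide)

/-- The triangle cap at nullity `6` on `≥ 14` points: `c₃ ≤ 36` (the landed cap: `56`). -/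
theorem triangles_le_thirtysix_of_nullity_six (M : Matroid α) [M.Finite]
    (hd : M.E.encard = M.eRank + ((6 : ℕ) : ℕ∞)) (hK : ∀ e, ¬ M.IsColoop e)
    (h0 : {P : Set α | P ⊆ M.E ∧ P.ncard = 2 ∧ M.Dep P}.ncard = 0) (hn : 14 ≤ M.E.ncard) :
    {X : Set α | X ⊆ M.E ∧ X.ncard = 3 ∧ M.eRk X ≤ 2}.ncard ≤ 36 := by
  have h := ncard_three_eRk_le_two_le_choose_succ_add_one M hd hK h0 (by omega)
  exact h.trans (by decide)

/-- The triangle cap at nullity `4` on `≥ 10` points: `c₃ ≤ 11` (the landed cap: `20`). -/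
theorem triangles_le_eleven_of_nullity_four (M : Matroid α) [M.Finite]
    (hd : M.E.encard = M.eRank + ((4 : ℕ) : ℕ∞)) (hK : ∀ e, ¬ M.IsColoop e)
    (h0 : {P : Set α | P ⊆ M.E ∧ P.ncard = 2 ∧ M.Dep P}.ncard = 0) (hn : 10 ≤ M.E.ncard) :
    {X : Set α | X ⊆ M.E ∧ X.ncard = 3 ∧ M.eRk X ≤ 2}.ncard ≤ 11 := by
  have h := ncard_three_eRk_le_two_le_choose_succ_add_one M hd hK h0 (by omega)
  exact h.trans (by decide)

end S1CFG

end PercRepro
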